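import Literature.IUT.HodgeTheaters.TemperedCoveringsNodNon
import Literature.IUT.HodgeTheaters.TemperedCoveringsChartsAt
import HarnessLib

/-!
# [IUTchI] Prop. 2.1 / 2.2 with (A3) BY NAME ([NodNon] Lem. 1.9 (ii)), and [SemiAnbd] Thm 3.7 (iii) AT THE ONE GRAPH `𝒢`

Mochizuki, *Inter-universal Teichmüller theory I*, kurims manuscript (May 2020), §2, Proposition 2.1 /
Proposition 2.2, p. 45 [cite: Mochizuki2012, Prop 2.1 p.45] (D-0012 claim key; series status DISPUTED;
nothing of the series is asserted here); Hoshi–Mochizuki [NodNon] Lemma 1.9 (ii)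
[cite: HoshiMochizukiNodNon2011, Lem 1.9 (ii) p.291] enters BY NAME exactly as in the original.

PROOF-ONLY companion (abc-iut cell, φ2-consumers programme, L5 block «φ2-L5» item L5c, seat
abc-iut-L3-d1) of `TemperedCoveringsNodNon.lean` (abc-iut-L5-t11 lineage): the SAME proofs of
`prop21_byName` and `prop22_inParticular_byName`, with the ∀-countable named fact
`ProfiniteSemiGraph.CompactInVerticial` ([SemiAnbd] Thm 3.7 (iii), F-1732) replaced by its per-graph form
`ProfiniteSemiGraph.CompactInVerticialAt 𝒢` (abc-iut-w4-d075) at the ONE graph `𝒢` of the chart (finite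
for the dual semi-graph of a pointed stable curve — the scope of print's proof of Thm 3.7 (iii) and of the
cell's finite-`𝔾` producer).  Port rule: `(hCV : CompactInVerticial)` ↦ `(hCV : CompactInVerticialAt 𝒢)`,
(A1) through `conj_le_of_compactInVerticial_at` (item L5a), decl suffix `_at`; everything else verbatim;
the original is untouched (its `hA3_of_verticialIntersectionNear` is reused by name).  Typed ≠ proved;
nothing here bears on [IUTchIII] Cor. 3.12.
-/

namespace Literature.IUT.HodgeTheaters

open Pointwise Filter
open _root_.Topology
open Literature.AnabelianGeometry.SemiGraphs (IsTempered IsProfiniteCompletion PSCDatum ProfiniteSemiGraph)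
open Literature.AnabelianGeometry.SemiGraphs.ProfiniteSemiGraph (TemperedPiChart verticialSubgroups
  CompactInVerticialAt VerticialInjective)
open Literature.AnabelianGeometry.AbsoluteAnabelian (IsCommensurablyTerminal)

universe u

namespace TemperedGraphGroupData

variable (D : TemperedGraphGroupData.{u}) {𝒢 : ProfiniteSemiGraph.{u}}

/-- **[IUTchI] Proposition 2.1 AS TYPED with EVERY printed input BY NAME, Thm 3.7 (iii) AT `𝒢`**
(`CompactInVerticialAt 𝒢`); other inputs as in the original `prop21_byName` (chart, `IsProfiniteCompletion`,
Galois domination, `PSCDatum.VerticialIntersectionNear`, the verticial family and node data).  φ2 twin of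
`prop21_byName`. ([IUTchI] Prop 2.1 p.45) [claim: Mochizuki2012, status: disputed] -/
theorem prop21_byName_at (c : TemperedPiChart 𝒢) (e : D.Tp ≃ₜ* c.G) (h𝒢 : 𝒢.Thm37Hypotheses)
    (hCV : CompactInVerticialAt 𝒢)
    (hPC : IsProfiniteCompletion
      ({ toMonoidHom := D.ι, continuous_toFun := D.ι_continuous } : D.Tp →ₜ* D.Hat))
    (hGal : ∀ S : ProfiniteSemiGraph.BTempCat 𝒢,
      Literature.AlgebraicGeometry.Frobenioids.IsConnectedObj S →
      ∃ (H : ProfiniteSemiGraph.BTempCat 𝒢) (_ : H ⟶ S),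
        Literature.AnabelianGeometry.SemiGraphs.IsGaloisObj H ∧
          Group.ResiduallyFinite (CategoryTheory.Aut H))
    (G : PSCDatum D.Hat) (hNN : G.VerticialIntersectionNear) (σ : 𝒢.graph.Vertex ≃ G.graph.V)
    (Λv : G.graph.V → Subgroup D.Tp)
    (hvert : ∀ v : 𝒢.graph.Vertex, (Λv (σ v)).map (e : D.Tp →* c.G) ∈ verticialSubgroups c v)
    (hΛv : ∀ v, (Λv v).map D.ι = G.vertGp v)
    (src tgt : G.graph.N → G.graph.V) (c₁ c₂ : G.graph.N → D.Tp)
    (hends : ∀ e, G.graph.nodeEnds e = s(src e, tgt e))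
    (h₁ : ∀ e, G.nodeGp e ≤ MulAut.conj (D.ι (c₁ e)) • G.vertGp (src e))
    (h₂ : ∀ e, G.nodeGp e ≤ MulAut.conj (D.ι (c₂ e)) • G.vertGp (tgt e))
    (hloop : ∀ e, src e = tgt e → (c₁ e)⁻¹ * c₂ e ∉ Λv (src e)) :
    D.ProfiniteConjugatesOfCompactSubgroups :=
  D.prop21_of_cosetTree_of_isProfiniteCompletion (D.isTempered_tp_of_chart c e) hPC
    (D.exists_residuallyFinite_quotient_of_chart c e hGal) Λv src tgt c₁ c₂
    (fun Λ hΛc _ => by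
      obtain ⟨v, t, h⟩ := D.conj_le_of_compactInVerticial_at c e h𝒢 hCV (fun v => Λv (σ v)) hvert Λ hΛc
      exact ⟨σ v, t, h⟩)
    (D.hA3_of_verticialIntersectionNear G hNN Λv hΛv src tgt c₁ c₂ hends h₁ h₂ hloop)

/-- **[IUTchI] Proposition 2.2, "in particular, `Π^tp_𝔾` is commensurably terminal in `Π̂_𝔾`", with
EVERY printed input BY NAME, Thm 3.7 (iii) AT `𝒢`** (`CompactInVerticialAt 𝒢`; plus `VerticialInjective`).
φ2 twin of `prop22_inParticular_byName`. ([IUTchI] Prop 2.2 p.45) [claim: Mochizuki2012, status: disputed] -/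
theorem prop22_inParticular_byName_at (c : TemperedPiChart 𝒢) (e : D.Tp ≃ₜ* c.G)
    (h𝒢 : 𝒢.Thm37Hypotheses) (hCV : CompactInVerticialAt 𝒢) (hVI : VerticialInjective.{u})
    (hPC : IsProfiniteCompletion
      ({ toMonoidHom := D.ι, continuous_toFun := D.ι_continuous } : D.Tp →ₜ* D.Hat))
    (hGal : ∀ S : ProfiniteSemiGraph.BTempCat 𝒢,
      Literature.AlgebraicGeometry.Frobenioids.IsConnectedObj S →
      ∃ (H : ProfiniteSemiGraph.BTempCat 𝒢) (_ : H ⟶ S),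
        Literature.AnabelianGeometry.SemiGraphs.IsGaloisObj H ∧
          Group.ResiduallyFinite (CategoryTheory.Aut H))
    (G : PSCDatum D.Hat) (hNN : G.VerticialIntersectionNear) (σ : 𝒢.graph.Vertex ≃ G.graph.V)
    (Λv : G.graph.V → Subgroup D.Tp)
    (hvert : ∀ v : 𝒢.graph.Vertex, (Λv (σ v)).map (e : D.Tp →* c.G) ∈ verticialSubgroups c v)
    (hΛv : ∀ v, (Λv v).map D.ι = G.vertGp v)
    (src tgt : G.graph.N → G.graph.V) (c₁ c₂ : G.graph.N → D.Tp)
    (hends : ∀ e, G.graph.nodeEnds e = s(src e, tgt e))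
    (h₁ : ∀ e, G.nodeGp e ≤ MulAut.conj (D.ι (c₁ e)) • G.vertGp (src e))
    (h₂ : ∀ e, G.nodeGp e ≤ MulAut.conj (D.ι (c₂ e)) • G.vertGp (tgt e))
    (hloop : ∀ e, src e = tgt e → (c₁ e)⁻¹ * c₂ e ∉ Λv (src e)) :
    IsCommensurablyTerminal D.ι.range := by
  obtain ⟨v₀, hv₀c, hv₀inf⟩ :=
    D.exists_infinite_compact_of_chart c e h𝒢 hVI (fun v => Λv (σ v)) hvert
  exact D.tp_isCommensurablyTerminal_of_cosetTree_of_isProfiniteCompletion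
    (D.isTempered_tp_of_chart c e) hPC (D.exists_residuallyFinite_quotient_of_chart c e hGal) Λv
    src tgt c₁ c₂
    (fun Λ hΛc _ => by
      obtain ⟨v, t, h⟩ := D.conj_le_of_compactInVerticial_at c e h𝒢 hCV (fun v => Λv (σ v)) hvert Λ hΛc
      exact ⟨σ v, t, h⟩)
    (D.hA3_of_verticialIntersectionNear G hNN Λv hΛv src tgt c₁ c₂ hends h₁ h₂ hloop) (σ v₀)
    hv₀c hv₀inf

end TemperedGraphGroupData

end Literature.IUT.HodgeTheaters
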